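import Mathlib.Analysis.CStarAlgebra.Matrix
import Literature.Computability.QuantumComplexity.ApproxImplementation
import HarnessLib

/-!
# Oblivious amplitude amplification (one round, subnormalisation `2`) and its robustness

Topic `Literature/Computability/QuantumComplexity`; infrastructure for the discharge of
`ajl_jonesApproxProblem_mem_PromiseBQP` (`JonesInBQP.lean`): the gates of the Aharonov–Jones–Landau
algorithm with golden-ratio entries will be implemented over Clifford+`T` by *block encodings with
subnormalisation `2`* followed by one round of **oblivious amplitude amplification** (Berry, Childs,
Cleve, Kothari, Somma 2014, Lemma 3.1, the case `sin θ = 1/2`, `ℓ = 1`: "a single application of `S`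
(using three applications of `U`) would produce the state `V|ψ⟩` exactly"; robust form: Berry, Childs,
Cleve, Kothari, Somma 2015).

Setting: a projection `Π` (here always the diagonal projection `projOn P` onto the basis states of a
set `P`, i.e. "these ancilla wires read `0`"), the reflection `R = 2Π − 1`, a unitary `W` (the block
encoding) and the OAA operator `oaaOp Π W = −W R Wᴴ R W`.

* **The cubic identity** (`proj_mul_oaaOp_mul_proj`, over any ring): for `Π² = Π` and `W` invertible
  with inverse `Wᴴ`, `Π (oaaOp Π W) Π = 3X − 4 X X' X` with `X = ΠWΠ`, `X' = ΠWᴴΠ`. In particular, if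
  `X = VΠ/2` for a unitary `V` commuting with `Π` then `Π (oaaOp Π W) Π = VΠ` exactly (BCCKS 2014,
  Lemma 3.1 with `sin θ = 1/2`); no "2D subspace lemma" is needed for one round.
* **Robustness** (`opNorm_proj_oaaOp_proj_sub_le`, `L²` operator norm of
  `Mathlib.Analysis.CStarAlgebra.Matrix`): if `‖2ΠWΠ − VΠ‖ ≤ ε` then
  `‖Π (oaaOp Π W) Π − VΠ‖ ≤ 3ε + (3/2)ε² + (1/2)ε³` (telescoping `BBᴴB − AAᴴA`).
* **Leakage and the implementation bound** (`oaaOp_implOn`): under the same hypothesis the unitary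
  `oaaOp Π W` implements `V` on `P`-supported inputs up to `9√ε` in the sense of
  `ApproxImplementation.lean` (`ImplOn P (oaaOp Π W) V (9√ε)`): the in-block error is `≤ 5ε` and, by
  unitarity and Pythagoras for `Π`, the out-of-block leakage is `≤ √(10ε)`.
* Bridges between the tree's `l2Norm` and the operator norm (`l2Norm_mulVec_le_opNorm_mul`,
  `opNorm_le_of_forall_l2Norm_le`), the diagonal projection `projOn P` and its algebra.

## References

* D. W. Berry, A. M. Childs, R. Cleve, R. Kothari, R. D. Somma, *Exponential improvement in precision
  for simulating sparse Hamiltonians*, STOC 2014 (arXiv:1312.1414), Lemma 3.1 (oblivious amplitude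
  amplification) and the proof of Thm. 1.1 after it (`sin² θ = 1/4`, one application of `S`; "we
  obtain a state `ε`-close to `V|ψ⟩` when we use `Ũ` instead of `U`") [BerryEtAl2014].
* D. W. Berry, A. M. Childs, R. Cleve, R. Kothari, R. D. Somma, *Simulating Hamiltonian dynamics with a
  truncated Taylor series*, Phys. Rev. Lett. 114 (2015) 090502 [BerryEtAl2015] — where the *robust*
  one-round analysis (the cubic `3Ṽ/2 − ṼṼ†Ṽ/2` for a non-unitary block) first appears; its text
  could not be materialised here, so the robust estimates below are proved from scratch and tagged
  with the 2014 lemma they perturb.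
-/

noncomputable section

namespace Literature.Computability.QuantumComplexity

open Matrix Finset

/-! ### The OAA operator and the cubic identity over a ring -/

section RingIdentity

variable {R : Type*} [Ring R]

/-- The reflection `2Π − 1` about the range of `Π`. [cite: BerryEtAl2014, Lemma 3.1] -/
def oaaReflect (Pj : R) : R := 2 • Pj - 1

/-- **The oblivious-amplitude-amplification operator** `−W R W' R W`, `R = 2Π − 1` (one round,
`W'` the inverse/adjoint of `W`; BCCKS's `S U = −U R U† R U`). [cite: BerryEtAl2014, Lemma 3.1] -/
def oaaOp (Pj W W' : R) : R := -(W * oaaReflect Pj * W' * oaaReflect Pj * W)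

/-- Expansion of `W R W' R W` (pure ring identity). [folklore] -/
theorem oaa_expand (Pj W W' : R) :
    W * oaaReflect Pj * W' * oaaReflect Pj * W =
      4 • (W * (Pj * (W' * (Pj * W)))) - 2 • (W * (Pj * (W' * W))) - 2 • (W * (W' * (Pj * W))) + W * (W' * W) := by
  simp only [oaaReflect]
  noncomm_ring

/-- **The cubic identity of one round of oblivious amplitude amplification**: if `Π² = Π` and
`W' W = W W' = 1` then `Π (oaaOp Π W W') Π = 3X − 4 X X' X` with `X = ΠWΠ`, `X' = ΠW'Π`. (For
`X = VΠ/2`, `X' = ΠVᴴ/2` with `V` unitary commuting with `Π` the right-hand side is `VΠ`: BCCKS 2014,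
Lemma 3.1 at `sin θ = 1/2`.) [cite: BerryEtAl2014, Lemma 3.1 (ℓ = 1, sin θ = 1/2) and proof of Thm. 1.1] -/
theorem proj_mul_oaaOp_mul_proj {Pj W W' : R} (hPj : Pj * Pj = Pj) (hW'W : W' * W = 1) (hWW' : W * W' = 1) :
    Pj * oaaOp Pj W W' * Pj =
      3 • (Pj * W * Pj) - 4 • ((Pj * W * Pj) * (Pj * W' * Pj) * (Pj * W * Pj)) := by
  have hPj' : ∀ x : R, Pj * (Pj * x) = Pj * x := fun x => by rw [← mul_assoc, hPj]
  have h1 : ∀ x : R, W' * (W * x) = x := fun x => by rw [← mul_assoc, hW'W, one_mul]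
  have h2 : ∀ x : R, W * (W' * x) = x := fun x => by rw [← mul_assoc, hWW', one_mul]
  rw [oaaOp, oaa_expand, hW'W, mul_one, h2]
  simp only [mul_neg, neg_mul, mul_sub, mul_add, sub_mul, add_mul, mul_smul_comm, smul_mul_assoc, mul_assoc, hPj', hPj]
  noncomm_ring

end RingIdentity

/-! ### The `L²` operator norm and the tree's `l2Norm` -/

section Norms

open scoped Matrix.Norms.L2Operator

variable {N : ℕ}

/-- `‖Aψ‖₂ ≤ ‖A‖ ‖ψ‖₂` for the `L²` operator norm. [folklore] -/
theorem l2Norm_mulVec_le_opNorm_mul (A : Matrix (Cryptography.QReg N) (Cryptography.QReg N) ℂ) (ψ : Cryptography.QReg N → ℂ) :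
    l2Norm (A *ᵥ ψ) ≤ ‖A‖ * l2Norm ψ := by
  have := Matrix.l2_opNorm_mulVec A (WithLp.toLp 2 ψ)
  simpa [l2Norm] using this

/-- A uniform vector bound gives an operator-norm bound. [folklore] -/
theorem opNorm_le_of_forall_l2Norm_le {A : Matrix (Cryptography.QReg N) (Cryptography.QReg N) ℂ} {c : ℝ} (hc : 0 ≤ c)
    (h : ∀ ψ, l2Norm (A *ᵥ ψ) ≤ c * l2Norm ψ) : ‖A‖ ≤ c := by
  rw [Matrix.cstar_norm_def]
  refine ContinuousLinearMap.opNorm_le_bound _ hc fun x => ?_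
  have hx : x = WithLp.toLp 2 x.ofLp := rfl
  rw [hx, Matrix.toEuclideanCLM_toLp]
  exact h x.ofLp

/-- Contractions have operator norm `≤ 1`. [folklore] -/
theorem opNorm_le_one_of_isContraction {M : Matrix (Cryptography.QReg N) (Cryptography.QReg N) ℂ} (h : IsContraction M) :
    ‖M‖ ≤ 1 :=
  opNorm_le_of_forall_l2Norm_le zero_le_one fun ψ => by rw [one_mul]; exact h ψ

/-- Unitaries have operator norm `≤ 1`. [cite: NielsenChuang2010, §2.1.6] -/
theorem opNorm_le_one_of_mem_unitaryGroup {U : Matrix (Cryptography.QReg N) (Cryptography.QReg N) ℂ}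
    (hU : U ∈ Matrix.unitaryGroup (Cryptography.QReg N) ℂ) : ‖U‖ ≤ 1 :=
  opNorm_le_one_of_isContraction (isContraction_of_mem_unitaryGroup hU)

/-- An operator-norm bound gives an implementation bound on every support condition. [folklore] -/
theorem implOn_of_opNorm_sub_le (P : Set (Cryptography.QReg N)) {M U : Matrix (Cryptography.QReg N) (Cryptography.QReg N) ℂ}
    {δ : ℝ} (h : ‖M - U‖ ≤ δ) : ImplOn P M U δ := by
  intro ψ _
  rw [← Matrix.sub_mulVec]
  exact (l2Norm_mulVec_le_opNorm_mul _ _).trans (mul_le_mul_of_nonneg_right h (l2Norm_nonneg ψ))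

end Norms

/-! ### The diagonal projection onto the basis states of a set -/

section Proj

open scoped Matrix.Norms.L2Operator

variable {N : ℕ}

/-- **The diagonal projection `Π_P`** onto the span of the basis states `|x⟩`, `x ∈ P` (for
`P` = "the ancilla wires read `0`" this is BCCKS's `Π = |0^μ⟩⟨0^μ| ⊗ 1`). [cite: BerryEtAl2014, Lemma 3.1] -/
def projOn (P : Set (Cryptography.QReg N)) : Matrix (Cryptography.QReg N) (Cryptography.QReg N) ℂ :=
  Matrix.diagonal (P.indicator 1)

/-- `Π_P ψ` keeps the amplitudes on `P` and kills the others. [folklore] -/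
theorem projOn_mulVec_apply (P : Set (Cryptography.QReg N)) (ψ : Cryptography.QReg N → ℂ) (x : Cryptography.QReg N) :
    (projOn P *ᵥ ψ) x = P.indicator ψ x := by
  rw [projOn, Matrix.mulVec_diagonal]
  by_cases hx : x ∈ P <;> simp [Set.indicator, hx]

/-- `Π_P² = Π_P`. [folklore] -/
theorem projOn_mul_projOn (P : Set (Cryptography.QReg N)) : projOn P * projOn P = projOn P := by
  rw [projOn, Matrix.diagonal_mul_diagonal]
  congr 1
  funext x
  by_cases hx : x ∈ P <;> simp [Set.indicator, hx]

/-- `Π_Pᴴ = Π_P`. [folklore] -/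
theorem projOn_conjTranspose (P : Set (Cryptography.QReg N)) : (projOn P)ᴴ = projOn P := by
  rw [projOn, Matrix.diagonal_conjTranspose]
  congr 1
  funext x
  by_cases hx : x ∈ P <;> simp [Set.indicator, hx]

/-- A state is supported on `P` iff `Π_P` fixes it. [folklore] -/
theorem suppIn_iff_projOn_mulVec_eq {P : Set (Cryptography.QReg N)} {ψ : Cryptography.QReg N → ℂ} :
    SuppIn P ψ ↔ projOn P *ᵥ ψ = ψ := by
  constructor
  · intro h
    funext x
    rw [projOn_mulVec_apply]
    by_cases hx : x ∈ P
    · rw [Set.indicator_of_mem hx]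
    · rw [Set.indicator_of_notMem hx, h x hx]
  · intro h x hx
    rw [← h, projOn_mulVec_apply, Set.indicator_of_notMem hx]

/-- `Π_P ψ` is supported on `P`. [folklore] -/
theorem suppIn_projOn_mulVec (P : Set (Cryptography.QReg N)) (ψ : Cryptography.QReg N → ℂ) : SuppIn P (projOn P *ᵥ ψ) :=
  fun x hx => by rw [projOn_mulVec_apply, Set.indicator_of_notMem hx]

/-- **Pythagoras for `Π_P`**: `‖ψ‖² = ‖Π_P ψ‖² + ‖ψ − Π_P ψ‖²`. [folklore] -/
theorem normSq_eq_normSq_projOn_add (P : Set (Cryptography.QReg N)) (ψ : Cryptography.QReg N → ℂ) :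
    Cryptography.normSq ψ = Cryptography.normSq (projOn P *ᵥ ψ) + Cryptography.normSq (ψ - projOn P *ᵥ ψ) := by
  unfold Cryptography.normSq
  rw [← Finset.sum_add_distrib]
  refine Finset.sum_congr rfl fun x _ => ?_
  rw [Pi.sub_apply, projOn_mulVec_apply]
  by_cases hx : x ∈ P
  · rw [Set.indicator_of_mem hx]; simp
  · rw [Set.indicator_of_notMem hx]; simp

/-- `Π_P` is a contraction. [folklore] -/
theorem isContraction_projOn (P : Set (Cryptography.QReg N)) : IsContraction (projOn P) := by
  intro ψ
  rw [l2Norm_eq_sqrt_normSq, l2Norm_eq_sqrt_normSq]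
  refine Real.sqrt_le_sqrt ?_
  rw [normSq_eq_normSq_projOn_add P ψ]
  exact le_add_of_nonneg_right (normSq_nonneg _)

/-- `‖Π_P‖ ≤ 1`. [folklore] -/
theorem opNorm_projOn_le_one (P : Set (Cryptography.QReg N)) : ‖projOn P‖ ≤ 1 :=
  opNorm_le_one_of_isContraction (isContraction_projOn P)

/-- A placed gate commutes with `Π_P` whenever membership in `P` only reads wires off the placement
(e.g. `P` = "these other ancillas are `0`"). [cite: NielsenChuang2010, §4.3] -/
theorem placeGate_mul_projOn_comm {k : ℕ} (e : Fin k ↪ Fin N) {P : Set (Cryptography.QReg N)}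
    (hP : ∀ x y : Cryptography.QReg N, (∀ i, i ∉ Set.range e → x i = y i) → (x ∈ P ↔ y ∈ P))
    (A : Matrix (Cryptography.QReg k) (Cryptography.QReg k) ℂ) :
    Cryptography.placeGate e A * projOn P = projOn P * Cryptography.placeGate e A := by
  ext x y
  rw [projOn, Matrix.mul_diagonal, Matrix.diagonal_mul, Cryptography.placeGate_apply]
  split_ifs with hxy
  · by_cases hx : x ∈ P
    · rw [Set.indicator_of_mem hx, Set.indicator_of_mem ((hP x y hxy).1 hx)]; simp
    · rw [Set.indicator_of_notMem hx, Set.indicator_of_notMem (fun hy => hx ((hP x y hxy).2 hy)), mul_zero, zero_mul]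
  · rw [zero_mul, mul_zero]

end Proj

/-! ### Robustness of one round of oblivious amplitude amplification -/

section Robust

open scoped Matrix.Norms.L2Operator

variable {N : ℕ}

/-- Telescoping of a cubic: `BBᴴB − AAᴴA = (B − A)BᴴB + A(B − A)ᴴB + AAᴴ(B − A)`. [folklore] -/
theorem cubic_telescope (A B : Matrix (Cryptography.QReg N) (Cryptography.QReg N) ℂ) :
    B * Bᴴ * B - A * Aᴴ * A = (B - A) * Bᴴ * B + A * (B - A)ᴴ * B + A * Aᴴ * (B - A) := by
  rw [Matrix.conjTranspose_sub]
  noncomm_ring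

/-- `(VΠ)(VΠ)ᴴ(VΠ) = VΠ` for `V` unitary. [folklore] -/
theorem vproj_cubic (P : Set (Cryptography.QReg N)) {V : Matrix (Cryptography.QReg N) (Cryptography.QReg N) ℂ}
    (hV : V ∈ Matrix.unitaryGroup (Cryptography.QReg N) ℂ) :
    (V * projOn P) * (V * projOn P)ᴴ * (V * projOn P) = V * projOn P := by
  have hVV : Vᴴ * V = 1 := Matrix.mem_unitaryGroup_iff'.1 hV
  rw [Matrix.conjTranspose_mul, projOn_conjTranspose]
  calc V * projOn P * (projOn P * Vᴴ) * (V * projOn P)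
      = V * (projOn P * projOn P) * (Vᴴ * V) * projOn P := by noncomm_ring
    _ = V * projOn P := by rw [projOn_mul_projOn, hVV, Matrix.mul_one, Matrix.mul_assoc, projOn_mul_projOn]

/-- **Robust oblivious amplitude amplification, in-block error.** Let `Π = Π_P`, `W` unitary, `V`
unitary, and suppose the block `ΠWΠ` is `ε`-close to `VΠ/2`: `‖2ΠWΠ − VΠ‖ ≤ ε`. Then the block of
`oaaOp Π W Wᴴ` is close to `VΠ`: `‖Π (oaaOp Π W Wᴴ) Π − VΠ‖ ≤ 3ε + (3/2)ε² + (1/2)ε³` (from the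
cubic identity, `2(ΠUΠ − VΠ) = 3(B − A) − (BBᴴB − AAᴴA)` with `B = 2ΠWΠ`, `A = VΠ`, and telescoping).
For `ε = 0` this is BCCKS's exact statement at `sin θ = 1/2`. [cite: BerryEtAl2014, Lemma 3.1 (ℓ = 1, sin θ = 1/2) and proof of Thm. 1.1] -/
theorem opNorm_proj_oaaOp_proj_sub_le (P : Set (Cryptography.QReg N)) {W V : Matrix (Cryptography.QReg N) (Cryptography.QReg N) ℂ}
    (hW : W ∈ Matrix.unitaryGroup (Cryptography.QReg N) ℂ) (hV : V ∈ Matrix.unitaryGroup (Cryptography.QReg N) ℂ) {ε : ℝ}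
    (hE : ‖(2 : ℂ) • (projOn P * W * projOn P) - V * projOn P‖ ≤ ε) :
    ‖projOn P * oaaOp (projOn P) W Wᴴ * projOn P - V * projOn P‖ ≤ 3 * ε + 3 / 2 * ε ^ 2 + 1 / 2 * ε ^ 3 := by
  set Pj := projOn P with hPjdef
  set X := Pj * W * Pj with hX
  set A := V * Pj with hA
  set B := (2 : ℂ) • X with hB
  have hε0 : 0 ≤ ε := (norm_nonneg _).trans hE
  have hWW : Wᴴ * W = 1 := Matrix.mem_unitaryGroup_iff'.1 hW
  have hWW' : W * Wᴴ = 1 := Matrix.mem_unitaryGroup_iff.1 hW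
  -- the cubic identity, with `X' = Xᴴ`
  have hX' : Pj * Wᴴ * Pj = Xᴴ := by
    rw [hX, Matrix.conjTranspose_mul, Matrix.conjTranspose_mul, hPjdef, projOn_conjTranspose, Matrix.mul_assoc]
  have hcubic : Pj * oaaOp Pj W Wᴴ * Pj = 3 • X - 4 • (X * Xᴴ * X) := by
    rw [proj_mul_oaaOp_mul_proj (projOn_mul_projOn P) hWW hWW', hX']
  -- `2 (PjUPj − A) = 3 (B − A) − (BBᴴB − AAᴴA)`
  have hBB : B * Bᴴ * B = (8 : ℂ) • (X * Xᴴ * X) := by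
    rw [hB, Matrix.conjTranspose_smul]
    simp only [Matrix.smul_mul, Matrix.mul_smul, smul_smul]
    norm_num
  have hAAA : A * Aᴴ * A = A := vproj_cubic P hV
  have key : (2 : ℂ) • (Pj * oaaOp Pj W Wᴴ * Pj - A) = (3 : ℂ) • (B - A) - (B * Bᴴ * B - A * Aᴴ * A) := by
    rw [hcubic, hAAA, hBB, hB, ← Nat.cast_smul_eq_nsmul ℂ 3, ← Nat.cast_smul_eq_nsmul ℂ 4]
    simp only [smul_sub, smul_smul]
    norm_num
    module
  -- norms
  have nPj : ‖Pj‖ ≤ 1 := opNorm_projOn_le_one P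
  have nV : ‖V‖ ≤ 1 := opNorm_le_one_of_mem_unitaryGroup hV
  have nA : ‖A‖ ≤ 1 := by
    rw [hA]; exact (norm_mul_le _ _).trans (by nlinarith [norm_nonneg V, norm_nonneg Pj])
  have nBA : ‖B - A‖ ≤ ε := by rw [hB, hX, hA]; exact hE
  have nB : ‖B‖ ≤ 1 + ε := by
    calc ‖B‖ = ‖A + (B - A)‖ := by rw [add_sub_cancel]
      _ ≤ ‖A‖ + ‖B - A‖ := norm_add_le _ _
      _ ≤ 1 + ε := add_le_add nA nBA
  have nBh : ‖Bᴴ‖ ≤ 1 + ε := by rw [Matrix.l2_opNorm_conjTranspose]; exact nB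
  have nBAh : ‖(B - A)ᴴ‖ ≤ ε := by rw [Matrix.l2_opNorm_conjTranspose]; exact nBA
  have nAh : ‖Aᴴ‖ ≤ 1 := by rw [Matrix.l2_opNorm_conjTranspose]; exact nA
  have ncubic : ‖B * Bᴴ * B - A * Aᴴ * A‖ ≤ ε * (1 + ε) * (1 + ε) + 1 * ε * (1 + ε) + 1 * 1 * ε := by
    rw [cubic_telescope]
    refine (norm_add_le _ _).trans (add_le_add ((norm_add_le _ _).trans (add_le_add ?_ ?_)) ?_)
    · exact (norm_mul_le _ _).trans (mul_le_mul ((norm_mul_le _ _).trans (mul_le_mul nBA nBh (norm_nonneg _) hε0))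
        nB (norm_nonneg _) (by positivity))
    · exact (norm_mul_le _ _).trans (mul_le_mul ((norm_mul_le _ _).trans (mul_le_mul nA nBAh (norm_nonneg _) zero_le_one))
        nB (norm_nonneg _) (by positivity))
    · exact (norm_mul_le _ _).trans (mul_le_mul ((norm_mul_le _ _).trans (mul_le_mul nA nAh (norm_nonneg _) zero_le_one))
        nBA (norm_nonneg _) (by positivity))
  have n2 : ‖(2 : ℂ) • (Pj * oaaOp Pj W Wᴴ * Pj - A)‖ ≤ 3 * ε + (ε * (1 + ε) * (1 + ε) + 1 * ε * (1 + ε) + 1 * 1 * ε) := by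
    rw [key]
    refine (norm_sub_le _ _).trans (add_le_add ?_ ncubic)
    rw [norm_smul]
    have : ‖(3 : ℂ)‖ = 3 := by simp
    rw [this]
    exact mul_le_mul_of_nonneg_left nBA (by norm_num)
  rw [norm_smul] at n2
  have h2 : ‖(2 : ℂ)‖ = 2 := by simp
  rw [h2] at n2
  nlinarith [n2]

/-- **One round of oblivious amplitude amplification implements `V` on `P`-supported inputs up to
`9√ε`.** With `Π = Π_P`, `W` and `V` unitary and `‖2ΠWΠ − VΠ‖ ≤ ε` (no commutation of `V` with
`Π` is needed: the hypothesis forces it approximately), the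
unitary `oaaOp Π W Wᴴ = −W R Wᴴ R W` satisfies `‖oaaOp ψ − Vψ‖₂ ≤ 9√ε ‖ψ‖₂` for every `ψ` supported on
`P`: in-block error `≤ 5ε` (previous theorem, `ε ≤ 1`) plus leakage `‖(1 − Π) oaaOp ψ‖₂ ≤ √(10ε)`
(unitarity and Pythagoras); for `ε > 1/5` the bound exceeds the trivial `2`. This is the form consumed
by the error calculus (`ImplOn`). [cite: BerryEtAl2014, Lemma 3.1 and proof of Thm. 1.1] -/
theorem oaaOp_implOn (P : Set (Cryptography.QReg N)) {W V : Matrix (Cryptography.QReg N) (Cryptography.QReg N) ℂ}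
    (hW : W ∈ Matrix.unitaryGroup (Cryptography.QReg N) ℂ) (hV : V ∈ Matrix.unitaryGroup (Cryptography.QReg N) ℂ)
    {ε : ℝ} (hE : ‖(2 : ℂ) • (projOn P * W * projOn P) - V * projOn P‖ ≤ ε) :
    ImplOn P (oaaOp (projOn P) W Wᴴ) V (9 * Real.sqrt ε) := by
  set Pj := projOn P with hPjdef
  set U := oaaOp Pj W Wᴴ with hUdef
  have hε0 : 0 ≤ ε := (norm_nonneg _).trans hE
  have hWW : Wᴴ * W = 1 := Matrix.mem_unitaryGroup_iff'.1 hW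
  have hWW' : W * Wᴴ = 1 := Matrix.mem_unitaryGroup_iff.1 hW
  -- `U` is unitary (a product of unitaries and reflections)
  have hPP : Pj * Pj = Pj := projOn_mul_projOn P
  have hRself : star (oaaReflect Pj) = oaaReflect Pj := by
    rw [oaaReflect, star_sub, star_one, star_nsmul, Matrix.star_eq_conjTranspose, hPjdef, projOn_conjTranspose]
  have hRR : oaaReflect Pj * oaaReflect Pj = 1 := by
    rw [oaaReflect, ← Nat.cast_smul_eq_nsmul ℂ 2]
    simp only [sub_mul, mul_sub, Matrix.smul_mul, Matrix.mul_smul, smul_smul, hPP, mul_one, one_mul]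
    norm_num
    module
  have hR : oaaReflect Pj ∈ Matrix.unitaryGroup (Cryptography.QReg N) ℂ := by
    rw [Matrix.mem_unitaryGroup_iff, hRself, hRR]
  have hWh : Wᴴ ∈ Matrix.unitaryGroup (Cryptography.QReg N) ℂ := by
    rw [Matrix.mem_unitaryGroup_iff, star_eq_conjTranspose, Matrix.conjTranspose_conjTranspose]; exact hWW
  have hU : U ∈ Matrix.unitaryGroup (Cryptography.QReg N) ℂ := by
    have hprod : W * oaaReflect Pj * Wᴴ * oaaReflect Pj * W ∈ Matrix.unitaryGroup (Cryptography.QReg N) ℂ :=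
      Submonoid.mul_mem _ (Submonoid.mul_mem _ (Submonoid.mul_mem _ (Submonoid.mul_mem _ hW hR) hWh) hR) hW
    rw [hUdef, oaaOp, Matrix.mem_unitaryGroup_iff, star_neg, neg_mul_neg]
    exact Matrix.mem_unitaryGroup_iff.1 hprod
  intro ψ hψ
  have hfix : Pj *ᵥ ψ = ψ := suppIn_iff_projOn_mulVec_eq.1 hψ
  -- in-block error
  have hin : l2Norm (Pj *ᵥ (U *ᵥ ψ) - V *ᵥ ψ) ≤ (3 * ε + 3 / 2 * ε ^ 2 + 1 / 2 * ε ^ 3) * l2Norm ψ := by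
    have e1 : Pj *ᵥ (U *ᵥ ψ) - V *ᵥ ψ = (Pj * U * Pj - V * Pj) *ᵥ ψ := by
      rw [Matrix.sub_mulVec, ← Matrix.mulVec_mulVec, ← Matrix.mulVec_mulVec, ← Matrix.mulVec_mulVec, hfix]
    rw [e1]
    exact (l2Norm_mulVec_le_opNorm_mul _ _).trans
      (mul_le_mul_of_nonneg_right (opNorm_proj_oaaOp_proj_sub_le P hW hV hE) (l2Norm_nonneg ψ))
  by_cases hsmall : 5 * ε ≤ 1
  · -- small ε: in-block error ≤ 5ε, leakage ≤ √(10 ε)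
    have hin' : l2Norm (Pj *ᵥ (U *ᵥ ψ) - V *ᵥ ψ) ≤ 5 * ε * l2Norm ψ := by
      refine hin.trans (mul_le_mul_of_nonneg_right ?_ (l2Norm_nonneg ψ))
      nlinarith [hε0, hsmall]
    -- leakage via Pythagoras: ‖Uψ‖² = ‖PjUψ‖² + ‖Uψ − PjUψ‖², ‖Uψ‖ = ‖ψ‖, ‖PjUψ‖ ≥ ‖Vψ‖ − 5ε‖ψ‖ = (1 − 5ε)‖ψ‖
    have hUψ : l2Norm (U *ᵥ ψ) = l2Norm ψ := l2Norm_mulVec_of_mem_unitaryGroup hU ψ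
    have hVψ : l2Norm (V *ᵥ ψ) = l2Norm ψ := l2Norm_mulVec_of_mem_unitaryGroup hV ψ
    have hPjU : (1 - 5 * ε) * l2Norm ψ ≤ l2Norm (Pj *ᵥ (U *ᵥ ψ)) := by
      have := l2Norm_sub_le (V *ᵥ ψ) (Pj *ᵥ (U *ᵥ ψ)) 0
      rw [sub_zero, sub_zero, hVψ, l2Norm_sub_comm] at this
      linarith
    have hleak : Cryptography.normSq (U *ᵥ ψ - Pj *ᵥ (U *ᵥ ψ)) ≤ 10 * ε * Cryptography.normSq ψ := by
      have hpy : Cryptography.normSq (U *ᵥ ψ) =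
          Cryptography.normSq (Pj *ᵥ (U *ᵥ ψ)) + Cryptography.normSq (U *ᵥ ψ - Pj *ᵥ (U *ᵥ ψ)) :=
        normSq_eq_normSq_projOn_add P (U *ᵥ ψ)
      rw [← l2Norm_sq, ← l2Norm_sq, hUψ] at hpy
      rw [← l2Norm_sq ψ]
      have h1 : ((1 - 5 * ε) * l2Norm ψ) ^ 2 ≤ l2Norm (Pj *ᵥ (U *ᵥ ψ)) ^ 2 :=
        pow_le_pow_left₀ (mul_nonneg (by linarith) (l2Norm_nonneg ψ)) hPjU 2
      nlinarith [h1, hpy, sq_nonneg (l2Norm ψ), hε0, sq_nonneg ε]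
    have hleak' : l2Norm (U *ᵥ ψ - Pj *ᵥ (U *ᵥ ψ)) ≤ Real.sqrt (10 * ε) * l2Norm ψ := by
      refine l2Norm_le_of_normSq_le (mul_nonneg (Real.sqrt_nonneg _) (l2Norm_nonneg ψ)) ?_
      rw [mul_pow, Real.sq_sqrt (by positivity), l2Norm_sq]
      exact hleak
    calc l2Norm (U *ᵥ ψ - V *ᵥ ψ)
        ≤ l2Norm (U *ᵥ ψ - Pj *ᵥ (U *ᵥ ψ)) + l2Norm (Pj *ᵥ (U *ᵥ ψ) - V *ᵥ ψ) := l2Norm_sub_le _ _ _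
      _ ≤ Real.sqrt (10 * ε) * l2Norm ψ + 5 * ε * l2Norm ψ := add_le_add hleak' hin'
      _ ≤ 9 * Real.sqrt ε * l2Norm ψ := by
          rw [← add_mul]
          refine mul_le_mul_of_nonneg_right ?_ (l2Norm_nonneg ψ)
          have hs : Real.sqrt (10 * ε) = Real.sqrt 10 * Real.sqrt ε := Real.sqrt_mul (by norm_num) ε
          have h10 : Real.sqrt 10 ≤ 4 := by
            rw [show (4 : ℝ) = Real.sqrt 16 by rw [show (16:ℝ) = 4 ^ 2 by norm_num, Real.sqrt_sq (by norm_num)]]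
            exact Real.sqrt_le_sqrt (by norm_num)
          have hεs : ε ≤ Real.sqrt ε := by
            have hε1 : ε ≤ 1 := by linarith
            calc ε = Real.sqrt ε * Real.sqrt ε := (Real.mul_self_sqrt hε0).symm
              _ ≤ Real.sqrt ε * 1 := mul_le_mul_of_nonneg_left (Real.sqrt_le_one.mpr hε1 |>.trans_eq' ?_) (Real.sqrt_nonneg _)
              _ = Real.sqrt ε := mul_one _
            · rfl
          nlinarith [Real.sqrt_nonneg ε, Real.sqrt_nonneg 10]
  · -- large ε: the trivial bound `2 ≤ 9√ε`
    push Not at hsmall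
    have hUψ : l2Norm (U *ᵥ ψ) = l2Norm ψ := l2Norm_mulVec_of_mem_unitaryGroup hU ψ
    have hVψ : l2Norm (V *ᵥ ψ) = l2Norm ψ := l2Norm_mulVec_of_mem_unitaryGroup hV ψ
    have htriv : l2Norm (U *ᵥ ψ - V *ᵥ ψ) ≤ 2 * l2Norm ψ := by
      have := l2Norm_sub_le (U *ᵥ ψ) 0 (V *ᵥ ψ)
      rw [sub_zero, zero_sub, l2Norm_neg, hUψ, hVψ] at this
      linarith
    refine htriv.trans (mul_le_mul_of_nonneg_right ?_ (l2Norm_nonneg ψ))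
    have h15 : (1 : ℝ) / 5 ≤ ε := by linarith
    have hs : Real.sqrt (1 / 5) ≤ Real.sqrt ε := Real.sqrt_le_sqrt h15
    have h45 : (2 : ℝ) / 9 ≤ Real.sqrt (1 / 5) := by
      rw [show (2 : ℝ) / 9 = Real.sqrt ((2 / 9) ^ 2) by rw [Real.sqrt_sq (by norm_num)]]
      exact Real.sqrt_le_sqrt (by norm_num)
    linarith

end Robust

end Literature.Computability.QuantumComplexity

end
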